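import Summits.QuantumFields.YangMills.Theorems.F4SubCurvatureDoorShortRootRigidityPlanarRigidity
import Mathlib
import HarnessLib

/-!
# TYPED RUNGS for stub H2 `HermitianPlanarRigidity` of SUB-LINE g22-A «HERMITIAN SLICE»
# (crux ⟨stmt-QuantumFields-23035⟩ `F4SubCurvatureDoor.ShortRootRigidity`, registered stub `:146 stub_oddModeRigidity`; seat ym-idea-3 g22)

Companion of `Cruxes/ShortRootRigidity/Lines/hermitian_slice.lean` (commit 7d6b9371ad68).  That file cannot be imported, so the three
definitions `IsHermitianPlanarLF`, `InHermitianPlanarClass`, `HermitianPlanarRigidity` are restated CHARACTER-IDENTICALLY here (same opens), and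
the heart H2 is cut into four rungs R1–R4 with the composition `hermitianPlanarRigidity_of_rungs : R1 → R2 → R3 → R4 → HermitianPlanarRigidity`
PROVED below.  Nothing is registered; rungs land `--supports stmt-QuantumFields-23035 --as helper` BY NAME (`theorem hermitianCone_holds :
HermitianCone`, …), and H2 then follows by this file's composition (a by-name prover of H2 restates the three defs and this proof verbatim).

* R1 `HermitianCone` (S–M): the frame measure of a Hermitian planar kernel is carried by the forward light cone `{E ≥ |p|}`.  Route: `Re ∘ k`
  satisfies `InPlanarClass` (evenness `Re k(−y) = Re k(y)` and real reflection positivity are read off the complex representation: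
  `k(−(t,x)) = k(θ₂(t,−x)) = k(t,−x) = conj k(t,x)` for `t ≠ 0`, continuity at `t = 0`; `Σ cᵢcⱼ k(θ₂yᵢ − yⱼ) = ∫ |Σ cᵢ e^{−tᵢE + i sᵢ p}|² dμ ≥ 0`)
  and `IsPlanarLF (Re ∘ k) μ` for the SAME `μ` (real part of the integrand); then ✓`planarConeSupport_holds`.
* R2 `HermitianAngularRung` (M): angular continuation of type `(2π/3, 6)`.  SIMPLER than announced in the line card: NO conjugated charts are
  needed — the three charts centred at `0°, 120°, 240°` are the frame-`e₀` tube function `F(ζ,β) = ∫ e^{−ζE} e^{iβp} dμ` composed with the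
  ROTATIONS of `D₃` (`k(ρ_{120°} y) = k y` from `θ₂ ∘ hexReflection`), each holomorphic on a strip of width `180°` (`(r cos z, r sin z)` lies in the
  tube `|Im β| < Re ζ` iff `cos (Re z) > 0`), agreeing on the `60°`-overlaps by the identity theorem (they agree on the real axis by the reflections
  of `D₃`: `k(polar r φ) = k(polar r (60° − φ))` from `hexReflection ∘ θ₂`-type identities); growth from the REAL majorant
  `‖F(ζ,β)‖ ≤ k(mk2 (Re ζ − |Im β|) 0) = k(r cos φ₀ e^{−|ψ|}, 0)` with `cos φ₀ ≥ 1/2` and the budget `‖y‖⁶‖k y‖ → 0`.  Pattern: ✓`stub_angularContinuation`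
  (`Theorems/F4SubCurvatureDoorAngularContinuation(.Charts).lean`, namespace `…AngularType`, charts `AngularChartA`).
* R3 `ThreeModeLaurent` (S–M, classical): an entire `2π/3`-periodic `G` with `‖G(φ+iψ)‖ = o(e^{6|ψ|})` is `c₀ + c₊ e^{3iz} + c₋ e^{−3iz}`
  (`H(w) := G(z)`, `w = e^{3iz}`, is holomorphic on `ℂ \ {0}` with `|H(w)| = o(|w|^{∓2})` at `0 / ∞` ⇒ Laurent coefficients vanish for `|n| ≥ 2`).
  Sibling of ✓`Theorems/F4SubCurvatureDoorPeriodicEntireRigidity.lean` (period `π/3`, `w = e^{6iz}`, conclusion constant).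
* R4 `BoostPositivityKill` (M–L, THE NEW STEP): a Hermitian planar kernel whose every circle trace is a three-mode trigonometric polynomial is radial.
  Route ((iv) of the line card, with the algebra corrected: `θ₂` ALONE gives `c₋ = −c₊`): `F` as in R2 on the full tube (aperture `1`); for fixed
  `r` the identity `F(r cos z, r sin z) = c₀ + c₊e^{3iz} + c₋e^{−3iz}` persists to the strip `|Re z| < π/2` (identity theorem); at `z = φ + iτ`
  the left side is the complex Laplace–Fourier transform of the BOOSTED measure `μ_τ := (Φ_τ)_* μ ≥ 0`, `Φ_τ(E,p) = (E ch τ + p sh τ, E sh τ + p ch τ)`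
  (change of variables; `μ_τ` again satisfies the integrability conjunct because `E ch τ + p sh τ ≥ e^{−|τ|} E` on the cone); so on `{t > 0}`
  `LF[μ_τ] = A + e^{−3τ} B + e^{3τ} C` with `A(polar r φ) = c₀(r)`, `B = c₊(r)e^{3iφ}`, `C = c₋(r)e^{−3iφ}` (coefficients = circle Fourier
  coefficients of `k`, continuous in `r`); the Vandermonde system at `τ = 0, ±1` writes `A, B, C` as `LF` of SIGNED measures `λ₀, λ₊, λ₋`
  (differences of positive boosted measures); uniqueness of the complex planar Laplace–Fourier transform of finite-on-`e^{−tE}` positive measures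
  (move negative parts across; pattern ✓`Theorems/F4SubCurvatureDoorPlanarLFFourierMeasure.lean` / ✓`…SliceFourierUniqueness.lean`) gives
  `μ_σ = λ₀ + e^{−3σ}λ₊ + e^{3σ}λ₋` for every `σ`, hence `λ₊ ≥ 0`, `λ₋ ≥ 0` (`σ → ∓∞` on each Borel set); `θ₂`-invariance of `k` forces `c₋ = −c₊`,
  i.e. `C(t,s) = −B(t,−s)`, i.e. `λ₋ = −(λ₊)ˇ` (`p ↦ −p`) `≤ 0`; so `λ₊ = λ₋ = 0`, `k = c₀(r)` on `{t > 0}`, and by `θ₂`, the `120°`-rotations and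
  continuity off `0`, `k` is radial off `0`, hence invariant under every linear isometry.  CHEAPEST FALSIFIER (run, kit j333305): on finite-mass
  models `k = Σ w_j[K₀(m_j r) + i b K₃(m_j r) sin 3φ]` the measure is `Σ w_j [1 + b p(3E²+p²)/m_j³] dp/(2E)` (identity checked to 4e-16), NOT
  positive for any `b ≠ 0` — Hermitian RP violated numerically for `b ∈ {0.2, 0.02, 0.002}` — exactly the sign pattern this rung exploits.

HONEST LABEL: R1–R4, H1–H4, `:146`, ⟨23035⟩, ⟨23125⟩, R2d and the Yang–Mills mass gap are OPEN.  No summit is proved by a line.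
-/

noncomputable section

namespace Summit.QuantumFields.YangMills.Cruxes.ShortRootRigidity.HermitianSliceRungs

open scoped Topology BigOperators RealInnerProductSpace
open Filter Set MeasureTheory
open Literature.MathematicalPhysics.QuantumLattice (timeReflection)
open Summit.QuantumFields.YangMills.Theorems.F4SubCurvatureDoorSliceDensityRegistered (E2)
open Summit.QuantumFields.YangMills.Theorems.F4SubCurvatureDoorSliceInClassRegistered (hexReflection InPlanarClass)
open Summit.QuantumFields.YangMills.Theorems.F4SubCurvatureDoorPlanarFrameTimeHolomorphyRegistered (mk2)
open Summit.QuantumFields.YangMills.Theorems.F4SubCurvatureDoorPlanarInitialApertureRegistered (IsPlanarLF HasAperture)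
open Summit.QuantumFields.YangMills.Cruxes.ShortRootRigidity.AngularType (polar)

/-! ## Vocabulary (character-identical with `Lines/hermitian_slice.lean`) -/

/-- `μ` is a frame Laplace–Fourier measure of the complex planar kernel `k` in the frame `e₀`, complex form (verbatim). [problem-side definition] -/
def IsHermitianPlanarLF (k : E2 → ℂ) (μ : Measure (ℝ × ℝ)) : Prop :=
  μ (Set.Iio 0 ×ˢ Set.univ) = 0 ∧
    ∀ t : ℝ, 0 < t → Integrable (fun z : ℝ × ℝ => Real.exp (-(t * z.1))) μ ∧
      ∀ x : ℝ, k (mk2 t x) = ∫ z, ((Real.exp (-(z.1 * t)) : ℝ) : ℂ) * Complex.exp (((z.2 * x : ℝ) : ℂ) * Complex.I) ∂μ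

/-- THE HERMITIAN PLANAR CLASS (verbatim). [problem-side definition] -/
def InHermitianPlanarClass (k : E2 → ℂ) : Prop :=
  ContinuousOn k {y | y ≠ 0} ∧
  (∃ C : ℝ, ∀ y, 1 ≤ ‖y‖ → ‖k y‖ ≤ C) ∧
  (∀ y, k (timeReflection 2 y) = k y) ∧
  (∀ y, k (hexReflection y) = k y) ∧
  (∃ μ : Measure (ℝ × ℝ), IsHermitianPlanarLF k μ) ∧
  Tendsto (fun y : E2 => ‖y‖ ^ 6 * ‖k y‖) (𝓝[≠] 0) (𝓝 0)

/-- **H2 «HERMITIAN PLANAR RIGIDITY»** (verbatim). [problem-side statement] -/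
def HermitianPlanarRigidity : Prop :=
  ∀ k : E2 → ℂ, InHermitianPlanarClass k → ∀ (R : E2 ≃ₗᵢ[ℝ] E2) (y : E2), y ≠ 0 → k (R y) = k y

/-- «HERMITIAN ANGULAR CONTINUATION OF TYPE `(2π/3, 6)`» for one complex planar kernel: on every circle the angular trace is the restriction
of an entire `2π/3`-periodic function of little-o exponential type `6` (the Hermitian sibling of `AngularType.AngularContinuation`, whose period
is `π/3`). [problem-side definition] -/
def HermitianAngularContinuation (k : E2 → ℂ) : Prop :=
  ∀ r : ℝ, 0 < r → ∃ G : ℂ → ℂ, Differentiable ℂ G ∧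
    (∀ φ : ℝ, G φ = k (polar r φ)) ∧
    (∀ z : ℂ, G (z + ((2 * Real.pi / 3 : ℝ) : ℂ)) = G z) ∧
    ∀ δ : ℝ, 0 < δ → ∃ Ψ : ℝ, ∀ φ ψ : ℝ, Ψ ≤ |ψ| → ‖G (φ + ψ * Complex.I)‖ ≤ δ * Real.exp (6 * |ψ|)

/-- «THREE-MODE FORM ON CIRCLES»: every circle trace of `k` is `c₀ + c₊ e^{3iφ} + c₋ e^{−3iφ}`. [problem-side definition] -/
def ThreeModeOnCircles (k : E2 → ℂ) : Prop :=
  ∀ r : ℝ, 0 < r → ∃ c₀ c₁ c₂ : ℂ, ∀ φ : ℝ,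
    k (polar r φ) = c₀ + c₁ * Complex.exp (3 * (φ : ℂ) * Complex.I) + c₂ * Complex.exp (-(3 * (φ : ℂ) * Complex.I))

/-! ## The four rungs -/

/-- **R1 «HERMITIAN CONE»** (S–M): the frame measure of a Hermitian planar kernel has aperture `1` (support in the forward light cone).
Route: `InPlanarClass (Re ∘ k)` + `IsPlanarLF (Re ∘ k) μ` + ✓`planarConeSupport_holds`. [problem-side statement] -/
def HermitianCone : Prop :=
  ∀ (k : E2 → ℂ) (μ : Measure (ℝ × ℝ)), InHermitianPlanarClass k → IsHermitianPlanarLF k μ → HasAperture μ 1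

/-- **R2 «HERMITIAN ANGULAR CONTINUATION»** (M): three rotated frame charts, no conjugation; growth from the real axis majorant and the budget.
[problem-side statement] -/
def HermitianAngularRung : Prop :=
  ∀ (k : E2 → ℂ) (μ : Measure (ℝ × ℝ)), InHermitianPlanarClass k → IsHermitianPlanarLF k μ → HasAperture μ 1 →
    HermitianAngularContinuation k

/-- **R3 «THREE-MODE LAURENT RIGIDITY»** (S–M, one complex variable): entire + `2π/3`-periodic + `o(e^{6|ψ|})` ⇒ three modes.
[problem-side statement] -/
def ThreeModeLaurent : Prop :=
  ∀ G : ℂ → ℂ, Differentiable ℂ G → (∀ z : ℂ, G (z + ((2 * Real.pi / 3 : ℝ) : ℂ)) = G z) →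
    (∀ δ : ℝ, 0 < δ → ∃ Ψ : ℝ, ∀ φ ψ : ℝ, Ψ ≤ |ψ| → ‖G (φ + ψ * Complex.I)‖ ≤ δ * Real.exp (6 * |ψ|)) →
    ∃ c₀ c₁ c₂ : ℂ, ∀ z : ℂ, G z = c₀ + c₁ * Complex.exp (3 * z * Complex.I) + c₂ * Complex.exp (-(3 * z * Complex.I))

/-- **R4 «BOOST-POSITIVITY KILL»** (M–L, the new step): positivity of the Lorentz-boosted frame measures kills the modes `±3`.
WHY IT MIGHT FAIL (formal, not mathematical): the uniqueness theorem for the complex planar Laplace–Fourier transform must be run for SIGNED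
measures (by rearrangement into positive ones) and the boosted measures must be shown to satisfy the integrability conjunct; both routine
on the cone `E ≥ |p|`. [problem-side statement] -/
def BoostPositivityKill : Prop :=
  ∀ (k : E2 → ℂ) (μ : Measure (ℝ × ℝ)), InHermitianPlanarClass k → IsHermitianPlanarLF k μ → HasAperture μ 1 →
    ThreeModeOnCircles k → ∀ (R : E2 ≃ₗᵢ[ℝ] E2) (y : E2), y ≠ 0 → k (R y) = k y

/-! ## Composition (PROVED): R1 → R2 → R3 → R4 → H2 -/

theorem threeModeOnCircles_of (r3 : ThreeModeLaurent) {k : E2 → ℂ} (hA : HermitianAngularContinuation k) :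
    ThreeModeOnCircles k := by
  intro r hr
  obtain ⟨G, hGd, hGk, hGp, hGg⟩ := hA r hr
  obtain ⟨c₀, c₁, c₂, hc⟩ := r3 G hGd hGp hGg
  exact ⟨c₀, c₁, c₂, fun φ => by rw [← hGk φ]; exact hc φ⟩

/-- H2 from the four rungs. -/
theorem hermitianPlanarRigidity_of_rungs (r1 : HermitianCone) (r2 : HermitianAngularRung) (r3 : ThreeModeLaurent)
    (r4 : BoostPositivityKill) : HermitianPlanarRigidity := by
  intro k hk R y hy
  obtain ⟨μ, hμ⟩ := hk.2.2.2.2.1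
  have hap : HasAperture μ 1 := r1 k μ hk hμ
  exact r4 k μ hk hμ hap (threeModeOnCircles_of r3 (r2 k μ hk hμ hap)) R y hy

/-! ## Rung stubs (sorried; NOT registered — land each BY NAME `--supports stmt-QuantumFields-23035 --as helper`) -/

/-- R1. -/
theorem rung_hermitianCone : HermitianCone := by
  sorry

/-- R2. -/
theorem rung_hermitianAngular : HermitianAngularRung := by
  sorry

/-- R3. -/
theorem rung_threeModeLaurent : ThreeModeLaurent := by
  sorry

/-- R4. -/
theorem rung_boostPositivityKill : BoostPositivityKill := by
  sorry

/-- H2 of the sub-line, from the rung stubs (kernel-checked modulo the four sorries above). -/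
theorem hermitianPlanarRigidity_of_rungStubs : HermitianPlanarRigidity :=
  hermitianPlanarRigidity_of_rungs rung_hermitianCone rung_hermitianAngular rung_threeModeLaurent rung_boostPositivityKill

end Summit.QuantumFields.YangMills.Cruxes.ShortRootRigidity.HermitianSliceRungs

end
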